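import Literature.MathematicalPhysics.QuantumFieldTheory.Balaban1983to89.T4HybridMatching
import Literature.MathematicalPhysics.QuantumFieldTheory.Balaban1983to89.T4OutputRate

/-!
# T4RecentScale — the recent-scale PER-FACTOR log-ratio statement of node U5b as a `Prop`, and its kernel-checked
propagation to the good-class sandwich of the hybrid lemma (cell `pub-balaban`, T4-DAG v2 §2 node U5b, §5 row T4-U5b.E;
typing + bookkeeping only)

HONEST FRAMING (T4-DAG PAGE 1).  The cell's T4 target is rung (B)+1: existence AND uniqueness of the ε → 0 limit of
Bałaban's unit-scale averaged loop expectations on a FIXED finite torus — strictly beyond ultraviolet stability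
([Balaban1988Convergent] Cor. 3 p. 264; [Balaban1989LargeFieldII] Thm 1 p. 355), NOT infinite volume, NOT a mass gap, NOT
the Clay problem.  Node U5b of the uniqueness spine compares, TERM BY TERM and FACTOR BY FACTOR, the final-scale density
expansions of two runs of the renormalization group (run A: K steps from spacing ε; run B: K + 1 steps from ε/L) driven
by the SAME unit-lattice field V after node U5a's synchronisation of the domain structures.  NOTHING OF THIS COMPARISON IS
PRINTED: the manuscripts under audit construct ONE run and bound its terms uniformly in ε.  This module therefore ASSERTS
NOTHING about Bałaban's objects.  It (i) types the node's estimate "∣log f^A − log f^B∣ ≤ C(θ_*^j + δ_j)·(localisation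
weight)" as a `Prop` over ABSTRACT factor ledgers (`FactorLogRatio`), (ii) kernel-checks the elementary real analysis by
which such per-factor bounds propagate — through products, through pending positive integral operations one level down,
through the scale slicing with the multiplicity of scale-j domains, and through the adjustment of term-dependent
field-independent constants — to EXACTLY the good-class clause consumed by the tree's hybrid lemma
(`T4WeightBudget.hybridSandwich_of_relWeightBound`, `T4HybridMatching.HybridSandwich.lower/upper`:
`exp(c − vol·δ_K)·a_τ ≤ b_τ ≤ exp(c + vol·δ_K)·a_τ`), and (iii) instantiates the shape for the ONE factor kind that has a
typed carrier in the tree, the small-field terms `E^{(j)}(X)` of `T4OutputRate` (node U3, `u3_geometric`).  The estimate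
itself (cell NEW ESTIMATES NE2/NE3/NE5/NE9/NE10 per factor kind) is beyond kernel reach and NOT in print; the paper-level
sketch with every printed input cited by page, the factor-kind table and the list of kinds lacking even a typed carrier
are the cell record `t4/T4-EST-U5b.md`.  Value = typed hypothesis shape with exact quantifier order + kernel bookkeeping of
an implication ⇐ named inputs; NOT summit progress.

Printed context (verbatim, read on the ×2 journal-page renders by this seat; the manuscripts under audit are quoted for
CONTEXT only — no disputed step of theirs is used anywhere below).
* THE TERMS.  [Balaban1988Convergent] p. 257 (2.18): *"The density ρ_k(V_k) can be represented as ρ_k(V_k) =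
  Σ_{{Ω_j},{Λ_j}} χ_k(Ω_k) T_k({Ω_j},{Λ_j}) exp A_k(1/g_k², U_k), (2.18) where the summation is over the admissible
  sequences of domains. Summation over the sequences {S_j} is included in the operation T_k, and the effective action A_k
  depends on the sequences {Ω_j}, {Λ_j}, {S_j}."*; pp. 257–258: *"Basically this operation is a composition of
  integrations restricted to large field regions in successive scales, and multiplications by characteristic functions,
  δ-functions defining renormalization transformations, and gauge fixing expressions."*; p. 258 (2.19)–(2.20): *"T_k(Z_k) =
  Π_{i=1}^n T_k(X_i). (2.19) The operations corresponding to disjoint regions commute"*, *"For a given large field region X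
  the operation T_k(X) can be factorized into a product of one-step operations"*.
* THE FACTOR KINDS.  p. 258 (2.23): *"The effective action A_k has the following general form: A_k(1/g_k², U_k) =
  −A(1/g_k², U_k) + 𝐄_k(U_k) + 𝐑_k(U_k) + 𝐁_k(U_k, A) − E_k. (2.23)"*; p. 259: *"The term 𝐄_k is the regular part of the
  action. […] This expression is fully renormalized, i.e. vacuum energy and coupling constant renormalization counterterms
  are included into it. The term 𝐑_k arises as the effect of the 𝐑-operations, and has localization properties similar to
  those of the term 𝐄_k. For this term we perform the vacuum energy renormalization only. The term 𝐁_k includes various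
  expressions localized closely to large field regions. It does not require any renormalization."*; (2.25): *"𝐄_k(U_k) =
  Σ_{j=1}^k [𝐄^{(j)}(Λ_j, g_{j−1}, U_k) − 𝐄^{(j)}(Λ_j, g_{j−1}, 1) − β_j(g_{j−1})A(φ_j, U_k)]. (2.25)"*; (2.26)–(2.27):
  *"𝐄^{(j)}(Λ_j, U_k) = Σ_{z∈Λ_j^0} 𝐄^{(j)}(Λ_j, U_k, z), (2.26) 𝐄^{(j)}(Λ_j, U_k, z) = Σ_{X∋z} 𝐄^{(j)}(X, U_k, z), (2.27) where
  the last sum is over localization domains X ∈ 𝐃_j contained in Λ_j"*; p. 260 (2.30)–(2.31): *"𝐑_k(U_k) = Σ_{j=1}^k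
  [𝐑^{(j)}(Λ_j, U_k) − 𝐑^{(j)}(Λ_j, 1)]. (2.30)"*, *"|𝐑^{(j)}(X, (𝐔, 𝐉))| ≤ g_j^{κ₀} exp(−κd_j(X)). (2.31)"* and *"After the vacuum
  energy renormalization we obtain a sum of marginal terms, i.e., terms with bounds O(1)(L^jη)^4 g_j^{κ₀} exp(−κd_j(X)). The
  sum over X is controlled by the exponential factor, and by the factor (L^jη)^4. The sum over j is controlled by
  g_j^{κ₀}."*; p. 261 (2.40)–(2.42): *"Now we can write the form of 𝐁_k. It is given by the sum Σ_{j=1}^k 𝐁^{(j)}(U_k, A,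
  {S_i}), (2.40) and a term in this sum has the localized representation 𝐁^{(j)}(U_k, A, {S_i}) = Σ_X 𝐁^{(j)}(X, U_k, A,
  {S_i∩X}), (2.41) where the sum is over domains X ∈ 𝐃_j such, that X∩Ω_j ≠ ∅, and X∩Z_j^~ ≠ ∅."*, *"(iv) it satisfies the
  bound |𝐁^{(j)}(X, (𝐔, 𝐉), A, {S_i∩X})| < B₀ exp(−κd_j(X)). (2.42)"*; p. 262: *"The constant E_k (depending on {Ω_j}, {Λ_j}
  also) is obtained by subtracting one-step vacuum energy expressions, generated in small field regions, from the initial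
  constant E."* (the field-independent constants are TERM-DEPENDENT — the reason for the binder `c : ι → ℝ` and the
  common-constant obligation of §4 below).  [Balaban1988Convergent, (2.18)–(2.31) pp. 257–260; (2.40)–(2.42) p. 261; p. 262]
* INSERTS AND PENDING OPERATIONS.  [Balaban1989LargeFieldI] p. 200: *"Let us now summarize the result of all the
  transformations we have done on the density ρ_k. We have obtained a density, which may not be equal to ρ_k, but is
  equivalent to it, in the sense that they have equal integrals. This density is written as a sum over large field
  regions."*; p. 201 (1.100) inserts, per component X_i, the quotient of δ_{G_i}(V′_k)χ(Λ_i)exp[−(1/g_k²)A(ζ_i,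
  U_{k,X_i}(V′_kV_{Λ_i}))] by its integral ∫dV′⌈_{Λ_i} of the same, and *"The above operation has the fundamental
  normalization property ∫dV_k(ℝ′ρ_k)(V_k) = ∫dV_k ρ_k(V_k). (1.102)"*.  [Balaban1989LargeFieldI, (1.99)–(1.102) pp. 200–201]
* THE PRINTED MECHANISM for a positive integral operation (used one level down in §2).  [Balaban1989LargeFieldII] p. 380:
  *"exponential density in the integral is positive. This implies the inequalities |𝐓′_k(X,(𝐔,𝐉))F| = |𝐓′_k(X,(U,0))e^σF| ≤
  𝐓′_k(X,(U,0))|e^σF| ≤ (𝐓′_k(X,(U,0))1) sup e^{|σ|}|F|, (1.73) […] The expression 𝐓′_k(X,(U,0))1 is obviously positive,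
  although it may be very small, hence 𝐓′_k(X,(𝐔,𝐉))1 ≠ 0, and from the above inequalities we obtain
  |(𝐓′_k(X,(𝐔,𝐉))1)^{−1}𝐓′_k(X,(𝐔,𝐉))F| ≤ e^{3sup|σ|} sup|F|. (1.75)"* and, same page, *"Similar bounds hold for vacuum energy
  counterterms and normalization constants, except that for the last we have the corresponding constant O(log g_j^{−2})
  instead of O(1)."*  [Balaban1989LargeFieldII, (1.73)–(1.75) p. 380]
* THE PRINTED MULTIPLICITY CHAIN (model of §3).  [Balaban1987RG1] p. 257 (0.26): *"Let us study implications of the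
  inequality (0.25). We obtain |Σ_{j=1}^k 𝐄^{(j)}(U_k)| ≤ Σ_{j=1}^k Σ_{X∈𝐃_j} E₀ exp(−κd_j(X)) ≤ Σ_{j=1}^k Σ_{□∈π_j} Σ_{X∈𝐃_j,X⊃□}
  E₀ exp(−κd_j(X)) ≤ Σ_{j=1}^k Σ_{□∈π_j} E₀O(1) = Σ_{j=1}^k E₀O(1)M^{−4}|T_1^{(j)}| ≤ E₀O(1)M^{−4}|T_1^{(k)}|η^{−4}, η = L^{−k}.
  (0.26)"* (tree `B12.scale_sum_le` / `B12.chain026_holds` type its two silent inputs).  [Balaban1987RG1, (0.24)–(0.26) p. 257]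
PRINTED SHAPE PRECEDENT for the whole node (outside the audited series): Gawędzki–Kupiainen's telescoping of two runs
differing by one initial step, cell record `t4/T4-LITERATURE.md` §3; King's η-rate [King1986] (3.73) p. 665 is the model
of the factor θ^j (see `T4OutputRate`, `T4EtaRate.rateFactor`).

## What is typed and what is proved

§1 SHAPES (binders only — nothing asserted).  A TERM of the final-scale expansion is abstracted to a FACTOR LEDGER: an
index type `ι`, the finite set `fac` of the term's factors, each with a `Kind` (the inventory (2.23)/(2.25)/(2.30)/
(2.40)/(1.100)/O3b, with the tree's carrier status in the constructor docstrings), a creation scale `sc i = j`, a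
localisation weight `w i ≥ 0` (e^{−κd_j(X)} for E/R/B-pieces (0.25)/(2.31)/(2.42); a large-field volume count for
normalisation constants, p. 380; the volume for the explicit action terms), and the two runs' values `fA i, fB i : V → ℝ`
as functions of the COMMON driving field `v : V` (node U5a: same V, same domains), required only on an admissible set
`Adm ⊆ V` (off `Adm` a characteristic function IDENTICAL in the two runs vanishes — `prod_sandwich_of_vanishing`).
`FactorSandwich` = zero-tolerant two-sided form `e^{c_i − r_i} f^A_i ≤ f^B_i ≤ e^{c_i + r_i} f^A_i`; `FactorLogBound` =
`|log f^B_i − log f^A_i − c_i| ≤ r_i` for positive factors, with FIELD-INDEPENDENT constants `c_i` (vacuum-energy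
subtractions 𝐄^{(j)}(X, 1), 𝐑^{(j)}(X, 1) and normalisation constants differ between the runs) and a GENERAL remainder
profile `r_i` (so that node U5.E may plug `min(SIZE, RATE)`); THE node statement `FactorLogRatio` = `FactorLogBound` with
the recent-scale profile `recentProfile … i = Ck(kind i)·(θ^{sc i} + δ(sc i))·w i` (θ = θ_* of nodes U1–U3, δ_j = node
U2's coupling discrepancy, e.g. `T4CouplingMatching.disc`, entering here as an abstract sequence).
§2 PROPAGATION [folklore]: log-bound ⇒ sandwich (`T4CauchySum.two_sided_of_abs_log_sub_le`); factor-wise ⇒ term-wise for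
products (`T4HybridMatching.abs_log_prod_sub_le`, `prod_sandwich`); the SLICE-LEVEL variant (`abs_log_prod_sub_le_of_slices`:
per-slice bounds on |Σ_{i: sc i = j}(log f^B_i − log f^A_i − c_i)| ≤ R_j add up — the form in which the printed old-scale
SIZE bounds (2.43)/(2.44) p. 263, which are slice sums WITH counterterm cancellation, can be entered by node U4′, while
per-factor RATE bounds give slice bounds by the triangle inequality, `slice_le_of_factorwise`, and both together give the
minimum, `slice_le_min`); one level down, a factor that is itself a positive integral of sandwiched integrands is
sandwiched with the same constant and remainder (`factorSandwich_of_inner`, `factorLogBound_of_innerExp` — the abstract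
form of (1.73)–(1.75); positivity of the reference integral = cell input D7/L1-pos, a hypothesis); off `Adm` both products
vanish (`prod_sandwich_of_vanishing`), so the sandwich of the term densities holds for EVERY v (`density_sandwich`).
§3 SCALE SLICING [folklore]: `sum_profile_le_of_slices` (Σ_i ρ(sc i)·w_i ≤ Σ_{j∈t} ρ_j·M_j whenever every scale-j slice
has total weight ≤ M_j); `Multiplicity fac sc w Cw vol Λ K` (W_j ≤ Cw·vol·Λ^{K−j}, Λ = L⁴: the (0.26) chain — sum over
domains through a cube ≤ K₀, number of scale-j cubes = Λ^{K−j} × number of final cubes) ⇒ `sum_profile_le_of_multiplicity`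
and its antidiagonal form `sum_rate_le_crossoverShape` (Σ_i C·θ^{sc i}·w_i ≤ Cw·vol·C·Σ_{(j,n): j+n=K} θ^j Λ^n — literally
the RATE branch `C θ^{p.1} Λ^{p.2}` of `T4Crossover.crossoverDelta` before the minimum with the SIZE branch is taken);
`theta_add_delta_le` (node U2's `T4CauchySum.InjectedRate C 0 θ δ` merges δ into the rate: θ^j + δ_{K,j} ≤ (1 + C)θ^j).
§4 HAND-OFF [folklore]: `sandwich_adjust` (a term sandwiched with its own constant C_τ = Σ_{i} c_i and remainder R_τ, and
|C_τ − c| ≤ s for the CLASS constant c, is sandwiched with (c, R_τ + s) — the COMMON-CONSTANT OBLIGATION of node U5.E made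
a binder: `T4CauchySum.MatchingModConstants` and `HybridSandwich` carry ONE t-independent constant per K, whereas E_k of
(2.23) depends on {Ω_j}, {Λ_j} (p. 262)); `goodTerm_sandwich` (density sandwich for every v + integrability + |C_τ − c| ≤ s +
R_τ + s ≤ vol·δ_K ⇒ `exp(c − vol·δ_K)·∫F^A ≤ ∫F^B ≤ exp(c + vol·δ_K)·∫F^A`, the clause of
`T4WeightBudget.hybridSandwich_of_relWeightBound` for one good term τ).
§5 THE ONE TYPED KIND [folklore]: `URate` = the conclusion shape of node U3 along the V-family (|E^A(X; g^A, U^A(v)) −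
E^B(X; g^B, U^B(v))| ≤ E₀′θ^{scale X}e^{−κd(X)} on Adm), obtained from `T4OutputRate.u3_geometric` under its hypotheses
uniformly in v (`uRate_of_u3`); the factor `f_X(v) = exp(E(X; g, U(v)) − E(X; g, 1))` then satisfies `FactorLogRatio` with
kind `smallFieldE`, `c_X = −(E^B(X,1) − E^A(X,1))`, `Ck ≡ E₀′`, `δ ≡ 0`, `w_X = e^{−κd(X)}` (`factorLogRatio_smallFieldE`).  The
gauge re-cut of the cell record `t4/T4-XREAD-U3X2.md` §4 RC1 is typed as a CHOICE OF GAUGE: `T4OutputRate.Carriers.gauge` is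
one abstract closeness gauge on the (𝐔, 𝐉) data; variant (α) takes it dominated by a sum g_U + g_J and needs BOTH the
background closeness (node U1b, NE3) AND the current closeness `CurrentsClose` (cell hazard H-U3-1′ — an EXPLICIT binder
here, `gaugeClose_of_split`); variant (β) takes a 𝐉-aware kernel-averaged gauge inside `LipBackground` (cell NE10, GAPS
G-pv12g4-4, NOT PRINTED).  Neither variant is asserted.

Deliberately NOT here: any statement about Bałaban's densities, T-operations, E/R/B-terms, inserts or D-terms (every
`def … : Prop` is a hypothesis SHAPE to be assumed by node U5.E, never used as a fact); the window / j⋆ arithmetic and the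
minimum with the old-scale sizes (tree `T4Crossover`); the weights of the bad class (tree `T4WeightBudget`, node U5c); the
synchronisation itself (tree `T4SyncThresholds`, node U5a); the coupling matching (tree `T4CouplingMatching`, node U2 —
cited by name only, not imported); the η-rates NE2/NE3/NE5 (trees `T4EtaRate`, `T4OutputRate`); the D-terms' dressing
kernels (trees `T4DressedR`, `T4OscSandwich`).  FACTOR KINDS WITHOUT A TYPED CARRIER in the tree as of this module (cell
record §4): `boundary` (𝐁^{(j)} depends on the fluctuation fields A of PENDING integrations, (2.40)–(2.42) — no functional
carrier with an A-argument), `insert` ((1.100) quotients), `pending` (T-operation values tied to scales / components —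
only the abstract integral lemmas of `T4HybridMatching` §1 and the `T4DressedR.Rop*` kernels), `dTerm` (observable
D-terms of node O3b — format NE1 not printed), `action` (the explicit −A(1/g_k², U_k) and −β_j A(φ_j, U_k) across two
lattice spacings — `T4EtaRate` types backgrounds, not the action functional), `vacuum` (trivial: r = 0; but the
common-constant obligation is untyped beyond `sandwich_adjust`); `rTerm` shares `T4OutputRate.Functional` with E₀ ↦
R₁g_j^{κ₀} but has no rate analysis of its own.

CITATION HEADER (lean-in-tree rule 2026-08-18).  Sources quoted: T. Bałaban, *Renormalization group approach to lattice
gauge field theories. I. Generation of effective actions in a small field approximation and a coupling constant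
renormalization in four dimensions*, Commun. Math. Phys. **109**, 249–301 (1987) [Balaban1987RG1] (cell paper B12 = [I];
held `paper:balaban1987-cmp109-rg-i-small-field`, journal page = PDF page + 248; renders `b2b-balaban-ref1/pages/1987-cmp109-
rg-I-small-field/…-p009/p011-x2.png`); T. Bałaban, *Convergent renormalization expansions for lattice gauge theories*, Commun.
Math. Phys. **119**, 243–285 (1988) [Balaban1988Convergent] (B14 = [III]; held `paper:balaban1988-cmp119-convergent-
renormalization`, journal page = PDF page + 242; renders `…/1988-cmp119-convergent-renormalization/…-p015/p016/p017/p018/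
p019/p020-x2.png`); T. Bałaban, *Large field renormalization. I. The basic step of the 𝐑 operation*, Commun. Math. Phys.
**122**, 175–202 (1989) [Balaban1989LargeFieldI] (B15; held `paper:balaban1989-cmp122-large-field-i`, journal page = PDF
page + 174; renders `…/1989-cmp122-large-field-I/…-p026/p027-x2.png`); T. Bałaban, *Large field renormalization. II.
Localization, exponentiation, and bounds for the 𝐑 operation*, Commun. Math. Phys. **122**, 355–392 (1989)
[Balaban1989LargeFieldII] (B16; held `paper:balaban1989-cmp122-large-field-ii`, journal page = PDF page + 354; render
`…/1989-cmp122-large-field-II/…-p026-x2.png`); C. King, *The U(1) Higgs model. I. The continuum limit*, Commun. Math. Phys.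
**102**, 649–677 (1986) [King1986] (PUBLISHED, outside the audited series; cited through `T4OutputRate` only).  The Bałaban
papers are manuscripts UNDER ADJUDICATION by the audit cell `pub-balaban`: NOTHING printed in them is asserted here.  NEW
module of unit `b2b-balaban-pv16-g4` (SURGE NODE PROVER #16 gen 4; journal claim T4-U5b.E 2026-08-18T20:53:03Z); imports
`T4HybridMatching` (hence `T4CauchySum`, Mathlib) and `T4OutputRate`; modifies nothing.
-/

namespace Literature.MathematicalPhysics.QuantumFieldTheory.Balaban1983to89.T4RecentScale

open Finset MeasureTheory
open scoped BigOperators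

/-! ## §1 Factor ledgers and the per-factor shapes (binders only — nothing asserted) -/

/-- INVENTORY OF FACTOR KINDS of a term of the final-scale expansion (2.18) with the action (2.23) of
[Balaban1988Convergent] and the inserts / pending operations of [Balaban1989LargeFieldI] (1.100), plus the cell's
observable-attached D-terms (T4-DAG node O3b, NOT printed).  The constructor docstrings record the printed locus and the
tree's carrier status; the type is DATA of a ledger, nothing is asserted by it. [cite: Balaban1988Convergent, (2.23) p.258] -/
inductive Kind
  /-- small-field pieces `exp(𝐄^{(j)}(X, U_k) − 𝐄^{(j)}(X, 1))`, (2.25)–(2.27) p. 259; carrier `T4OutputRate.Functional`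
  (typed; rate = node U3, `T4OutputRate.u3_geometric`) -/
  | smallFieldE
  /-- 𝐑-operation pieces `exp(𝐑^{(j)}(X, U_k) − 𝐑^{(j)}(X, 1))`, (2.30)–(2.31) p. 260; shares `T4OutputRate.Functional`
  with `E₀ ↦ R₁g_j^{κ₀}` (T4OutputRate header (4)); no rate analysis of its own -/
  | rTerm
  /-- boundary pieces `exp 𝐁^{(j)}(X, U_k, A, {S_i∩X})`, (2.40)–(2.42) p. 261 — depend on the fluctuation fields A of
  pending integrations; NO typed carrier -/
  | boundary
  /-- the inserted small-field quotients of (1.100) p. 201 of [Balaban1989LargeFieldI]; NO typed carrier -/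
  | insert
  /-- values of pending T-operations (2.19)–(2.22) p. 258 / 𝕋″_k of (1.99), one level down; only abstract integral
  lemmas (`T4HybridMatching` §1, `T4DressedR.Rop*`) -/
  | pending
  /-- observable-attached D-terms of the cell's node O3b (format NE1, NOT printed); dressing kernels `T4DressedR`,
  `T4OscSandwich`, no locality-weighted carrier -/
  | dTerm
  /-- the explicit action terms `−A(1/g_k², U_k)` and `−β_j(g_{j−1})A(φ_j, U_k)` of (2.23)/(2.25) compared across two
  lattice spacings; backgrounds typed in `T4EtaRate`, the action functional not -/
  | action
  /-- field-independent constants (E_k of (2.23), the subtractions 𝐄^{(j)}(Λ_j, g, 1), 𝐑^{(j)}(Λ_j, 1), normalisation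
  constants p. 380 of [Balaban1989LargeFieldII]): remainder 0, constant arbitrary — TERM-DEPENDENT (p. 262) -/
  | vacuum
  deriving DecidableEq

/-- ZERO-TOLERANT PER-FACTOR SANDWICH (shape): on the admissible set `Adm` of the common driving field, every factor of
the ledger satisfies `0 ≤ f^A_i(v)` and `e^{c_i − r_i} f^A_i(v) ≤ f^B_i(v) ≤ e^{c_i + r_i} f^A_i(v)` — characteristic
functions identical in the two runs after node U5a's synchronisation are the case `c_i = r_i = 0`. [folklore] -/
def FactorSandwich {ι V : Type*} (Adm : Set V) (fac : Finset ι) (fA fB : ι → V → ℝ) (c r : ι → ℝ) : Prop :=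
  ∀ v ∈ Adm, ∀ i ∈ fac,
    0 ≤ fA i v ∧ Real.exp (c i - r i) * fA i v ≤ fB i v ∧ fB i v ≤ Real.exp (c i + r i) * fA i v

/-- PER-FACTOR LOG-RATIO BOUND with a GENERAL remainder profile (shape): on `Adm`, every factor of the ledger is
positive in both runs and `|log f^B_i(v) − log f^A_i(v) − c_i| ≤ r_i` with a FIELD-INDEPENDENT constant `c_i` (the two
runs' vacuum-energy subtractions and normalisation constants differ; p. 262 of [Balaban1988Convergent], p. 380 of
[Balaban1989LargeFieldII]).  Node U5.E may take `r_i = min(SIZE_i, RATE_i)`. [cite: Balaban1988Convergent, §2 p.262] -/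
def FactorLogBound {ι V : Type*} (Adm : Set V) (fac : Finset ι) (fA fB : ι → V → ℝ) (c r : ι → ℝ) : Prop :=
  ∀ v ∈ Adm, ∀ i ∈ fac, 0 < fA i v ∧ 0 < fB i v ∧ |Real.log (fB i v) - Real.log (fA i v) - c i| ≤ r i

/-- THE RECENT-SCALE PROFILE of node U5b: factor `i` of kind `kind i`, created at scale `sc i = j`, with localisation
weight `w i`, is allowed the remainder `Ck(kind i)·(θ^j + δ_j)·w i` — `θ` the η-rate of nodes U1–U3 (cell NE2/NE3/NE5,
convention of `T4EtaRate.rateFactor`, King's L^{−γk}), `δ_j` node U2's coupling discrepancy at scale j.  NOT PRINTED — print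
has ONE run and its uniformity, [Balaban1987RG1] p. 259: *"For the effective action corresponding to the unit lattice, where
k = K = log_L 1/ε, the above bound is uniform in the lattice spacing ε."* [cite: Balaban1987RG1, Thm 1 p.259] -/
def recentProfile {ι : Type*} (kind : ι → Kind) (sc : ι → ℕ) (w : ι → ℝ) (Ck : Kind → ℝ) (θ : ℝ) (δ : ℕ → ℝ)
    (i : ι) : ℝ :=
  Ck (kind i) * (θ ^ sc i + δ (sc i)) * w i

/-- **THE NODE-U5b STATEMENT as a `Prop`** (cell NEW ESTIMATE, NOT PRINTED; T4-DAG v2 §2 U5b): on the admissible set,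
every factor of the term's ledger — of every kind — is positive in both runs and matched modulo its field-independent
constant with the recent-scale profile, `|log f^B_i(v) − log f^A_i(v) − c_i| ≤ Ck(kind i)·(θ^{sc i} + δ(sc i))·w i`.
Quantifier order: the constants `c_i`, the kind constants `Ck`, `θ`, `δ` are chosen BEFORE `v`.  To be ASSUMED by node
U5.E, never used as a fact; instantiated in the tree only for `Kind.smallFieldE` (§5). [cite: Balaban1988Convergent, (2.23)-(2.27) pp.258-259] -/
def FactorLogRatio {ι V : Type*} (Adm : Set V) (fac : Finset ι) (kind : ι → Kind) (sc : ι → ℕ) (w : ι → ℝ)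
    (fA fB : ι → V → ℝ) (c : ι → ℝ) (Ck : Kind → ℝ) (θ : ℝ) (δ : ℕ → ℝ) : Prop :=
  FactorLogBound Adm fac fA fB c (recentProfile kind sc w Ck θ δ)

/-- Unfolding: the node statement is the general log-bound with the recent-scale profile. [folklore] -/
theorem factorLogRatio_iff {ι V : Type*} {Adm : Set V} {fac : Finset ι} {kind : ι → Kind} {sc : ι → ℕ}
    {w : ι → ℝ} {fA fB : ι → V → ℝ} {c : ι → ℝ} {Ck : Kind → ℝ} {θ : ℝ} {δ : ℕ → ℝ} :
    FactorLogRatio Adm fac kind sc w fA fB c Ck θ δ ↔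
      ∀ v ∈ Adm, ∀ i ∈ fac, 0 < fA i v ∧ 0 < fB i v ∧
        |Real.log (fB i v) - Real.log (fA i v) - c i| ≤ Ck (kind i) * (θ ^ sc i + δ (sc i)) * w i :=
  Iff.rfl

/-! ## §2 Propagation: factors ⇒ term, slices, one level down, off the admissible set -/

section Propagation

variable {ι V : Type*} {Adm : Set V} {fac : Finset ι} {fA fB : ι → V → ℝ} {c r : ι → ℝ}

/-- A per-factor log-bound is a per-factor sandwich (`T4CauchySum.two_sided_of_abs_log_sub_le`). [folklore] -/
theorem FactorLogBound.sandwich (h : FactorLogBound Adm fac fA fB c r) : FactorSandwich Adm fac fA fB c r := by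
  intro v hv i hi
  obtain ⟨hA, hB, hlog⟩ := h v hv i hi
  exact ⟨hA.le, T4CauchySum.two_sided_of_abs_log_sub_le hA hB hlog⟩

/-- Monotonicity of the sandwich in the remainders. [folklore] -/
theorem FactorSandwich.mono (h : FactorSandwich Adm fac fA fB c r) {r' : ι → ℝ} (hr : ∀ i ∈ fac, r i ≤ r' i) :
    FactorSandwich Adm fac fA fB c r' := by
  intro v hv i hi
  obtain ⟨hA, hl, hu⟩ := h v hv i hi
  refine ⟨hA, le_trans ?_ hl, hu.trans ?_⟩
  · exact mul_le_mul_of_nonneg_right (Real.exp_le_exp.mpr (by linarith [hr i hi])) hA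
  · exact mul_le_mul_of_nonneg_right (Real.exp_le_exp.mpr (by linarith [hr i hi])) hA

/-- IDENTICAL NONNEGATIVE FACTORS (the characteristic functions after node U5a's synchronisation, cell input D8) are
sandwiched with `c = r = 0`. [folklore] -/
theorem factorSandwich_of_eq (h : ∀ v ∈ Adm, ∀ i ∈ fac, 0 ≤ fA i v ∧ fB i v = fA i v) :
    FactorSandwich Adm fac fA fB (fun _ => 0) (fun _ => 0) := by
  intro v hv i hi
  obtain ⟨hA, hBA⟩ := h v hv i hi
  refine ⟨hA, ?_, ?_⟩ <;> simp [hBA]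

/-- Two sandwiched sub-ledgers (e.g. the positive factors and the characteristic functions) form one sandwiched
ledger. [folklore] -/
theorem FactorSandwich.union [DecidableEq ι] {fac₁ fac₂ : Finset ι} (h₁ : FactorSandwich Adm fac₁ fA fB c r)
    (h₂ : FactorSandwich Adm fac₂ fA fB c r) : FactorSandwich Adm (fac₁ ∪ fac₂) fA fB c r := by
  intro v hv i hi
  rcases Finset.mem_union.mp hi with h | h
  · exact h₁ v hv i h
  · exact h₂ v hv i h

/-- **FACTOR-WISE ⇒ TERM-WISE, sandwich form** (`T4HybridMatching.prod_sandwich`): on the admissible set the products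
of the two runs' factors are sandwiched with constant `Σ_i c_i` and remainder `Σ_i r_i`. [folklore] -/
theorem FactorSandwich.prod (h : FactorSandwich Adm fac fA fB c r) :
    ∀ v ∈ Adm, Real.exp (∑ i ∈ fac, c i - ∑ i ∈ fac, r i) * ∏ i ∈ fac, fA i v ≤ ∏ i ∈ fac, fB i v ∧
      ∏ i ∈ fac, fB i v ≤ Real.exp (∑ i ∈ fac, c i + ∑ i ∈ fac, r i) * ∏ i ∈ fac, fA i v := fun v hv =>
  T4HybridMatching.prod_sandwich fac (fun i hi => (h v hv i hi).1) (fun i hi => (h v hv i hi).2.1)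
    (fun i hi => (h v hv i hi).2.2)

/-- **FACTOR-WISE ⇒ TERM-WISE, logarithmic form** (`T4HybridMatching.abs_log_prod_sub_le`): on the admissible set
`|log ∏ f^B − log ∏ f^A − Σ_i c_i| ≤ Σ_i r_i`. [folklore] -/
theorem FactorLogBound.log_prod (h : FactorLogBound Adm fac fA fB c r) :
    ∀ v ∈ Adm, |Real.log (∏ i ∈ fac, fB i v) - Real.log (∏ i ∈ fac, fA i v) - ∑ i ∈ fac, c i| ≤ ∑ i ∈ fac, r i :=
  fun v hv => T4HybridMatching.abs_log_prod_sub_le fac (fun i hi => (h v hv i hi).1) (fun i hi => (h v hv i hi).2.1)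
    (fun i hi => (h v hv i hi).2.2)

/-- **SLICE-LEVEL PROPAGATION.**  If the factors are keyed (by creation scale, or any key) into a finite set `t` of
slices and each SLICE satisfies `|Σ_{i ∈ fac, sc i = j} (log f^B_i − log f^A_i − c_i)| ≤ R_j` (a bound that may use
cancellations inside the slice — the form of the printed size bounds (2.43)/(2.44) p. 263 of [Balaban1988Convergent],
which are slice sums with the coupling counterterm), then `|log ∏ f^B − log ∏ f^A − Σ_i c_i| ≤ Σ_{j∈t} R_j`. [folklore] -/
theorem abs_log_prod_sub_le_of_slices {sc : ι → ℕ} {t : Finset ℕ} {R : ℕ → ℝ} {v : V}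
    (hsc : ∀ i ∈ fac, sc i ∈ t) (hA : ∀ i ∈ fac, 0 < fA i v) (hB : ∀ i ∈ fac, 0 < fB i v)
    (hR : ∀ j ∈ t, |∑ i ∈ fac with sc i = j, (Real.log (fB i v) - Real.log (fA i v) - c i)| ≤ R j) :
    |Real.log (∏ i ∈ fac, fB i v) - Real.log (∏ i ∈ fac, fA i v) - ∑ i ∈ fac, c i| ≤ ∑ j ∈ t, R j := by
  rw [Real.log_prod fun i hi => (hB i hi).ne', Real.log_prod fun i hi => (hA i hi).ne',
    ← Finset.sum_sub_distrib, ← Finset.sum_sub_distrib,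
    ← Finset.sum_fiberwise_of_maps_to hsc (fun i => Real.log (fB i v) - Real.log (fA i v) - c i)]
  exact (Finset.abs_sum_le_sum_abs _ _).trans (Finset.sum_le_sum hR)

/-- Per-factor bounds give slice bounds by the triangle inequality (the RATE branch enters slices this way). [folklore] -/
theorem slice_le_of_factorwise {sc : ι → ℕ} {v : V} (j : ℕ)
    (h : ∀ i ∈ fac, |Real.log (fB i v) - Real.log (fA i v) - c i| ≤ r i) :
    |∑ i ∈ fac with sc i = j, (Real.log (fB i v) - Real.log (fA i v) - c i)| ≤ ∑ i ∈ fac with sc i = j, r i :=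
  (Finset.abs_sum_le_sum_abs _ _).trans (Finset.sum_le_sum fun i hi => h i (Finset.mem_filter.mp hi).1)

/-- Two slice bounds (a SIZE bound `S` and a RATE bound `ρ`) give the minimum — node U4′'s crossover per slice
(`T4Crossover.crossoverDelta` takes `min` slice by slice). [folklore] -/
theorem slice_le_min {x S ρ : ℝ} (hS : |x| ≤ S) (hρ : |x| ≤ ρ) : |x| ≤ min S ρ :=
  le_min hS hρ

/-- **ONE LEVEL DOWN, sandwich form** (`T4HybridMatching.integral_sandwich`; the printed mechanism is (1.73)–(1.75) p. 380
of [Balaban1989LargeFieldII]): if factor `i` of each run is a pending positive integral operation applied to integrands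
`FA i v`, `FB i v` that are nonnegative resp. sandwiched `e^{c_i − r_i} FA ≤ FB ≤ e^{c_i + r_i} FA` almost everywhere and
integrable, then the integrated factors are sandwiched with the same `c_i, r_i`.  (Any characteristic function or
nonnegative weight of the operation is part of the measure or of the integrand.) [folklore] -/
theorem factorSandwich_of_inner {X : ι → Type*} [∀ i, MeasurableSpace (X i)] {ν : ∀ i, Measure (X i)}
    {FA FB : ∀ i, V → X i → ℝ}
    (hint : ∀ v ∈ Adm, ∀ i ∈ fac, Integrable (FA i v) (ν i) ∧ Integrable (FB i v) (ν i))
    (hpos : ∀ v ∈ Adm, ∀ i ∈ fac, 0 ≤ᵐ[ν i] FA i v)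
    (hsw : ∀ v ∈ Adm, ∀ i ∈ fac, (∀ᵐ x ∂(ν i), Real.exp (c i - r i) * FA i v x ≤ FB i v x) ∧
      (∀ᵐ x ∂(ν i), FB i v x ≤ Real.exp (c i + r i) * FA i v x)) :
    FactorSandwich Adm fac (fun i v => ∫ x, FA i v x ∂(ν i)) (fun i v => ∫ x, FB i v x ∂(ν i)) c r := by
  intro v hv i hi
  obtain ⟨hIA, hIB⟩ := hint v hv i hi
  obtain ⟨hl, hu⟩ := hsw v hv i hi
  exact ⟨integral_nonneg_of_ae (hpos v hv i hi), T4HybridMatching.integral_sandwich hIA hIB hl hu⟩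

/-- **ONE LEVEL DOWN, exponent form** (`T4HybridMatching.abs_log_integral_exp_sub_le`): if factor `i` is
`∫ exp(e_i(v, x)) dν_i(x)` in each run, the reference integrals are positive (cell input D7 / L1-pos — a hypothesis) and
the EXPONENTS are matched pointwise, `|e^B_i(v,x) − e^A_i(v,x) − c_i| ≤ r_i` a.e., then the integrated factors satisfy the
per-factor log-bound with the same `c_i, r_i` — a pending T-integrand matched one level down IS a matched factor. [folklore] -/
theorem factorLogBound_of_innerExp {X : ι → Type*} [∀ i, MeasurableSpace (X i)] {ν : ∀ i, Measure (X i)}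
    {eA eB : ∀ i, V → X i → ℝ}
    (hint : ∀ v ∈ Adm, ∀ i ∈ fac, Integrable (fun x => Real.exp (eA i v x)) (ν i) ∧
      Integrable (fun x => Real.exp (eB i v x)) (ν i))
    (hpos : ∀ v ∈ Adm, ∀ i ∈ fac, 0 < ∫ x, Real.exp (eA i v x) ∂(ν i) ∧ 0 < ∫ x, Real.exp (eB i v x) ∂(ν i))
    (hexp : ∀ v ∈ Adm, ∀ i ∈ fac, ∀ᵐ x ∂(ν i), |eB i v x - eA i v x - c i| ≤ r i) :
    FactorLogBound Adm fac (fun i v => ∫ x, Real.exp (eA i v x) ∂(ν i))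
      (fun i v => ∫ x, Real.exp (eB i v x) ∂(ν i)) c r := by
  intro v hv i hi
  obtain ⟨hIA, hIB⟩ := hint v hv i hi
  obtain ⟨hpA, hpB⟩ := hpos v hv i hi
  exact ⟨hpA, hpB, T4HybridMatching.abs_log_integral_exp_sub_le hIA hIB hpA (hexp v hv i hi)⟩

/-- OFF THE ADMISSIBLE SET: if some factor vanishes in BOTH runs at `v` (a characteristic function identical after node
U5a's synchronisation), both products vanish and every sandwich holds trivially. [folklore] -/
theorem prod_sandwich_of_vanishing {v : V} (h0 : ∃ i ∈ fac, fA i v = 0 ∧ fB i v = 0) (C R : ℝ) :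
    Real.exp (C - R) * ∏ i ∈ fac, fA i v ≤ ∏ i ∈ fac, fB i v ∧
      ∏ i ∈ fac, fB i v ≤ Real.exp (C + R) * ∏ i ∈ fac, fA i v := by
  obtain ⟨i, hi, hAi, hBi⟩ := h0
  rw [Finset.prod_eq_zero hi hAi, Finset.prod_eq_zero hi hBi]
  simp

/-- **THE TERM DENSITIES ARE SANDWICHED FOR EVERY DRIVING FIELD**: a per-factor sandwich on `Adm` plus, off `Adm`, a
factor vanishing in both runs, give `e^{Σc − Σr} ∏ f^A(v) ≤ ∏ f^B(v) ≤ e^{Σc + Σr} ∏ f^A(v)` for all `v` (the input of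
the final integration over the unit-lattice field). [folklore] -/
theorem density_sandwich (h : FactorSandwich Adm fac fA fB c r)
    (hoff : ∀ v, v ∉ Adm → ∃ i ∈ fac, fA i v = 0 ∧ fB i v = 0) (v : V) :
    Real.exp (∑ i ∈ fac, c i - ∑ i ∈ fac, r i) * ∏ i ∈ fac, fA i v ≤ ∏ i ∈ fac, fB i v ∧
      ∏ i ∈ fac, fB i v ≤ Real.exp (∑ i ∈ fac, c i + ∑ i ∈ fac, r i) * ∏ i ∈ fac, fA i v := by
  by_cases hv : v ∈ Adm
  · exact h.prod v hv
  · exact prod_sandwich_of_vanishing (hoff v hv) _ _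

/-- The run-A density (a product of nonnegative factors on `Adm`, vanishing off `Adm`) is nonnegative everywhere —
the input `ha` of `T4HybridMatching.HybridSandwich.of_termwise` at density level. [folklore] -/
theorem density_nonneg (h : FactorSandwich Adm fac fA fB c r)
    (hoff : ∀ v, v ∉ Adm → ∃ i ∈ fac, fA i v = 0 ∧ fB i v = 0) (v : V) : 0 ≤ ∏ i ∈ fac, fA i v := by
  by_cases hv : v ∈ Adm
  · exact Finset.prod_nonneg fun i hi => (h v hv i hi).1
  · obtain ⟨i, hi, hAi, -⟩ := hoff v hv
    rw [Finset.prod_eq_zero hi hAi]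

end Propagation

/-! ## §3 Scale slicing, multiplicity of scale-j domains, and the crossover's rate branch -/

section Slicing

variable {ι : Type*} {fac : Finset ι} {sc : ι → ℕ} {w : ι → ℝ}

/-- **SLICING**: if every factor's scale lies in `t`, the profile is nonnegative on `t`, and each scale-`j` slice of
the ledger has total localisation weight at most `M j`, then `Σ_i ρ(sc i)·w_i ≤ Σ_{j∈t} ρ_j·M_j`. [folklore] -/
theorem sum_profile_le_of_slices {t : Finset ℕ} {ρ M : ℕ → ℝ} (hsc : ∀ i ∈ fac, sc i ∈ t)
    (hρ : ∀ j ∈ t, 0 ≤ ρ j) (hM : ∀ j ∈ t, ∑ i ∈ fac with sc i = j, w i ≤ M j) :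
    ∑ i ∈ fac, ρ (sc i) * w i ≤ ∑ j ∈ t, ρ j * M j := by
  rw [← Finset.sum_fiberwise_of_maps_to hsc (fun i => ρ (sc i) * w i)]
  refine Finset.sum_le_sum fun j hj => ?_
  have hslice : ∑ i ∈ fac with sc i = j, ρ (sc i) * w i = ρ j * ∑ i ∈ fac with sc i = j, w i := by
    rw [Finset.mul_sum]
    exact Finset.sum_congr rfl fun i hi => by rw [(Finset.mem_filter.mp hi).2]
  rw [hslice]
  exact mul_le_mul_of_nonneg_left (hM j hj) (hρ j hj)

/-- HYPOTHESIS SHAPE — MULTIPLICITY OF SCALE-j DOMAINS PER UNIT FINAL VOLUME: for every creation scale `j ≤ K` the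
scale-`j` slice of the term's ledger has total localisation weight at most `Cw · vol · Λ^{K−j}` (`Λ = L⁴`; `vol` = number
of final unit cubes).  Printed model: the (0.26) chain p. 257 of [Balaban1987RG1] — the sum of e^{−κd_j(X)} over domains
through a cube is O(1) and the number of scale-`j` cubes is the volume in scale-`j` units (tree `B12.scale_sum_le`,
`B12.chain026_holds` with their two silent inputs); the sentence *"The sum over X is controlled by the exponential factor,
and by the factor (L^jη)^4"* p. 260 of [Balaban1988Convergent] is the same count.  For a run-A/run-B ledger this is a
hypothesis about the synchronised structures, NOT printed. [cite: Balaban1987RG1, (0.26) p.257] -/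
def Multiplicity (fac : Finset ι) (sc : ι → ℕ) (w : ι → ℝ) (Cw vol Λ : ℝ) (K : ℕ) : Prop :=
  ∀ j ≤ K, ∑ i ∈ fac with sc i = j, w i ≤ Cw * vol * Λ ^ (K - j)

/-- **MULTIPLICITY ⇒ THE PER-SCALE SUM**: with all creation scales `≤ K` and a nonnegative per-scale coefficient `ρ`,
`Σ_i ρ(sc i)·w_i ≤ Cw · vol · Σ_{j ≤ K} ρ_j Λ^{K−j}` — the node text's "per unit final volume the scale-j discrepancy is
≤ C(θ_*^j + δ_j) L^{4(K−j)}", summed over the scales present. [folklore] -/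
theorem sum_profile_le_of_multiplicity {Cw vol Λ : ℝ} {K : ℕ} {ρ : ℕ → ℝ} (hsc : ∀ i ∈ fac, sc i ≤ K)
    (hρ : ∀ j ≤ K, 0 ≤ ρ j) (hM : Multiplicity fac sc w Cw vol Λ K) :
    ∑ i ∈ fac, ρ (sc i) * w i ≤ Cw * vol * ∑ j ∈ Finset.range (K + 1), ρ j * Λ ^ (K - j) := by
  have hsc' : ∀ i ∈ fac, sc i ∈ Finset.range (K + 1) := fun i hi =>
    Finset.mem_range.mpr (Nat.lt_succ_of_le (hsc i hi))
  have hρ' : ∀ j ∈ Finset.range (K + 1), 0 ≤ ρ j := fun j hj =>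
    hρ j (Nat.le_of_lt_succ (Finset.mem_range.mp hj))
  have hM' : ∀ j ∈ Finset.range (K + 1), ∑ i ∈ fac with sc i = j, w i ≤ Cw * vol * Λ ^ (K - j) := fun j hj =>
    hM j (Nat.le_of_lt_succ (Finset.mem_range.mp hj))
  calc ∑ i ∈ fac, ρ (sc i) * w i ≤ ∑ j ∈ Finset.range (K + 1), ρ j * (Cw * vol * Λ ^ (K - j)) :=
        sum_profile_le_of_slices hsc' hρ' hM'
    _ = Cw * vol * ∑ j ∈ Finset.range (K + 1), ρ j * Λ ^ (K - j) := by
        rw [Finset.mul_sum]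
        exact Finset.sum_congr rfl fun j _ => by ring

/-- The per-scale sum in ANTIDIAGONAL form (`j` = scale of creation, `n = K − j` = remaining scales), the indexing of
`T4CauchySum.delta` and `T4Crossover.crossoverDelta`. [folklore] -/
theorem sum_range_eq_sum_antidiagonal (ρ : ℕ → ℝ) (Λ : ℝ) (K : ℕ) :
    ∑ j ∈ Finset.range (K + 1), ρ j * Λ ^ (K - j) = ∑ p ∈ antidiagonal K, ρ p.1 * Λ ^ p.2 :=
  (Finset.Nat.sum_antidiagonal_eq_sum_range_succ (fun j n => ρ j * Λ ^ n) K).symm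

/-- **THE RATE BRANCH OF THE CROSSOVER**: for the recent-scale profile with the coupling discrepancy already merged
(`ρ_j = C θ^j`, `theta_add_delta_le`) and multiplicity `Cw`, the term's total remainder is at most
`Cw · vol · Σ_{j+n=K} C θ^j Λ^n` — literally `vol ×` the un-minimised rate branch `C θ^{p.1} Λ^{p.2}` of
`T4Crossover.crossoverDelta` (node U4′ then takes the minimum with the printed old-scale sizes slice by slice,
`slice_le_min`). [folklore] -/
theorem sum_rate_le_crossoverShape {Cw vol Λ C θ : ℝ} {K : ℕ} (hsc : ∀ i ∈ fac, sc i ≤ K) (hC : 0 ≤ C) (hθ : 0 ≤ θ)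
    (hM : Multiplicity fac sc w Cw vol Λ K) :
    ∑ i ∈ fac, C * θ ^ sc i * w i ≤ Cw * vol * ∑ p ∈ antidiagonal K, C * θ ^ p.1 * Λ ^ p.2 := by
  have h := sum_profile_le_of_multiplicity (ρ := fun j => C * θ ^ j) hsc (fun j _ => mul_nonneg hC (pow_nonneg hθ j)) hM
  rw [sum_range_eq_sum_antidiagonal (fun j => C * θ ^ j) Λ K] at h
  simpa [mul_assoc] using h

/-- **MERGING δ INTO THE RATE**: node U2 delivers the coupling discrepancy in the shape `T4CauchySum.InjectedRate C 0 θ δ`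
(`0 ≤ δ K j ≤ C θ^j` for `j ≤ K`; tree `T4CouplingMatching.injectedRate_of_runs_eventual` is such an instance under its
hypotheses), whence `θ^j + δ K j ≤ (1 + C) θ^j`. [folklore] -/
theorem theta_add_delta_le {C θ : ℝ} {δ : ℕ → ℕ → ℝ} (h : T4CauchySum.InjectedRate C 0 θ δ) {K j : ℕ} (hj : j ≤ K) :
    θ ^ j + δ K j ≤ (1 + C) * θ ^ j := by
  have h2 := (h K j hj).2
  rw [pow_zero, mul_one] at h2
  linarith

/-- With the discrepancy merged, the recent-scale profile is dominated by a pure θ-rate profile: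
`Ck·(θ^j + δ_{K,j})·w ≤ Ck(1 + C)·θ^j·w` for `Ck, w ≥ 0`, `j ≤ K`. [folklore] -/
theorem recentProfile_le_rate {ι : Type*} {kind : ι → Kind} {sc : ι → ℕ} {w : ι → ℝ} {Ck : Kind → ℝ} {θ C : ℝ}
    {δ : ℕ → ℕ → ℝ} (h : T4CauchySum.InjectedRate C 0 θ δ) {K : ℕ} {i : ι} (hi : sc i ≤ K) (hCk : 0 ≤ Ck (kind i))
    (hw : 0 ≤ w i) :
    recentProfile kind sc w Ck θ (δ K) i ≤ Ck (kind i) * (1 + C) * θ ^ sc i * w i := by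
  unfold recentProfile
  have h1 := theta_add_delta_le h hi
  have : Ck (kind i) * (θ ^ sc i + δ K (sc i)) ≤ Ck (kind i) * ((1 + C) * θ ^ sc i) :=
    mul_le_mul_of_nonneg_left h1 hCk
  calc Ck (kind i) * (θ ^ sc i + δ K (sc i)) * w i ≤ Ck (kind i) * ((1 + C) * θ ^ sc i) * w i :=
        mul_le_mul_of_nonneg_right this hw
    _ = Ck (kind i) * (1 + C) * θ ^ sc i * w i := by ring

end Slicing

/-! ## §4 Hand-off to the hybrid lemma: term-dependent constants and the good-class clause -/

section Handoff

/-- **THE COMMON-CONSTANT OBLIGATION as a binder**: a term sandwiched with ITS OWN field-independent constant `Cτ`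
(= Σ_i c_i over its ledger) and remainder `Rτ`, whose constant deviates from the CLASS constant `c` by at most `s`, is
sandwiched with `(c, Rτ + s)`.  (`T4CauchySum.MatchingModConstants` and `T4HybridMatching.HybridSandwich` carry ONE
t-independent constant per K, whereas the constant E_k of (2.23) depends on {Ω_j}, {Λ_j} — p. 262 of
[Balaban1988Convergent]; the size of `s` on the good class is node U5.E's to bound.) [folklore] -/
theorem sandwich_adjust {a b Cτ Rτ c s : ℝ} (ha : 0 ≤ a) (hl : Real.exp (Cτ - Rτ) * a ≤ b)
    (hu : b ≤ Real.exp (Cτ + Rτ) * a) (hs : |Cτ - c| ≤ s) :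
    Real.exp (c - (Rτ + s)) * a ≤ b ∧ b ≤ Real.exp (c + (Rτ + s)) * a := by
  obtain ⟨hs1, hs2⟩ := abs_le.mp hs
  constructor
  · exact (mul_le_mul_of_nonneg_right (Real.exp_le_exp.mpr (by linarith)) ha).trans hl
  · exact hu.trans (mul_le_mul_of_nonneg_right (Real.exp_le_exp.mpr (by linarith)) ha)

/-- Monotonicity of a two-sided sandwich in the remainder (to reach the class remainder `vol · δ_K`). [folklore] -/
theorem sandwich_mono {a b c R R' : ℝ} (ha : 0 ≤ a) (hl : Real.exp (c - R) * a ≤ b) (hu : b ≤ Real.exp (c + R) * a)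
    (hR : R ≤ R') : Real.exp (c - R') * a ≤ b ∧ b ≤ Real.exp (c + R') * a :=
  ⟨(mul_le_mul_of_nonneg_right (Real.exp_le_exp.mpr (by linarith)) ha).trans hl,
    hu.trans (mul_le_mul_of_nonneg_right (Real.exp_le_exp.mpr (by linarith)) ha)⟩

/-- **THE GOOD-CLASS CLAUSE FOR ONE TERM** (the shape consumed by `T4WeightBudget.hybridSandwich_of_relWeightBound` and
`T4HybridMatching.HybridSandwich.lower/upper`): if the two runs' term densities `FA, FB` (functions of the common
unit-lattice field, integrable for the final integration `μ`) are sandwiched for EVERY field with the term's own constant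
`Cτ` and remainder `Rτ` (`density_sandwich`), `FA ≥ 0`, the term's constant deviates from the class constant `c` by at most
`s`, and `Rτ + s ≤ vol · δK`, then the term VALUES `a_τ = ∫ FA dμ`, `b_τ = ∫ FB dμ` satisfy
`exp(c − vol·δK)·a_τ ≤ b_τ ≤ exp(c + vol·δK)·a_τ`. [folklore] -/
theorem goodTerm_sandwich {V : Type*} [MeasurableSpace V] {μ : Measure V} {FA FB : V → ℝ} {Cτ Rτ c s vol δK : ℝ}
    (hFA : Integrable FA μ) (hFB : Integrable FB μ) (hpos : ∀ v, 0 ≤ FA v)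
    (hl : ∀ v, Real.exp (Cτ - Rτ) * FA v ≤ FB v) (hu : ∀ v, FB v ≤ Real.exp (Cτ + Rτ) * FA v)
    (hs : |Cτ - c| ≤ s) (hR : Rτ + s ≤ vol * δK) :
    Real.exp (c - vol * δK) * ∫ v, FA v ∂μ ≤ ∫ v, FB v ∂μ ∧
      ∫ v, FB v ∂μ ≤ Real.exp (c + vol * δK) * ∫ v, FA v ∂μ := by
  obtain ⟨h1, h2⟩ := T4HybridMatching.integral_sandwich hFA hFB (Filter.Eventually.of_forall hl)
    (Filter.Eventually.of_forall hu)
  have ha : 0 ≤ ∫ v, FA v ∂μ := integral_nonneg hpos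
  obtain ⟨h3, h4⟩ := sandwich_adjust ha h1 h2 hs
  exact sandwich_mono ha h3 h4 hR

/-- The same clause read as node U5's log-matching for a single positive term (`T4CauchySum.abs_log_integral_sub_le`
shape): `|log b_τ − log a_τ − c| ≤ vol · δK`. [folklore] -/
theorem goodTerm_abs_log_sub_le {a b c r : ℝ} (ha : 0 < a) (hl : Real.exp (c - r) * a ≤ b)
    (hu : b ≤ Real.exp (c + r) * a) : |Real.log b - Real.log a - c| ≤ r := by
  have hb : 0 < b := lt_of_lt_of_le (mul_pos (Real.exp_pos _) ha) hl
  have hlow := Real.log_le_log (mul_pos (Real.exp_pos _) ha) hl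
  rw [Real.log_mul (Real.exp_pos _).ne' ha.ne', Real.log_exp] at hlow
  have hupp := Real.log_le_log hb hu
  rw [Real.log_mul (Real.exp_pos _).ne' ha.ne', Real.log_exp] at hupp
  rw [abs_le]
  constructor <;> linarith

end Handoff

/-! ## §5 The one typed kind: small-field terms `E^{(j)}(X)` through node U3 (`T4OutputRate`) -/

section SmallFieldE

open T4OutputRate

variable {C : Carriers} {V : Type*}

/-- CONSUMER SHAPE of node U3 ALONG THE V-FAMILY (NOT PRINTED; cell NE3 + NE5 + NE9 combined as in
`T4OutputRate.u3_geometric`): for every admissible driving field `v` and every domain `X`,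
`|E^A(X; g^A, U^A(v)) − E^B(X; g^B, U^B(v))| ≤ E₀′ θ^{scale X} e^{−κ d(X)}`. [cite: Balaban1987RG1, Thm 1 p.259] -/
def URate (EA : Functional C C.BgA) (EB : Functional C C.BgB) (gA gB : ℕ → ℝ) (uA : V → C.BgA) (uB : V → C.BgB)
    (Adm : Set V) (E₀' θ κ : ℝ) : Prop :=
  ∀ v ∈ Adm, ∀ X : C.Dom, |EA gA (uA v) X - EB gB (uB v) X| ≤ E₀' * θ ^ C.scale X * Real.exp (-(κ * C.d X))

/-- Node U3's three brackets, uniformly along the V-family: `T4OutputRate.u3_geometric` at every admissible `v` gives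
`URate` with `E₀′ = a + b + C₅`. [folklore] -/
theorem uRate_of_u3 {W : Set (ℕ → ℝ)} {EA : Functional C C.BgA} {EB : Functional C C.BgB} {κ θ C₅ : ℝ}
    {Λ : ℕ → ℕ → ℝ} {CU : (ℕ → ℝ) → ℕ → ℝ} (h9 : NE9 EA W κ Λ) (hU : LipBackground EA W κ CU)
    (h5 : NE5 EA EB W κ θ C₅) {gA gB : ℕ → ℝ} (hgA : gA ∈ W) (hgB : gB ∈ W) {uA : V → C.BgA} {uB : V → C.BgB}
    {Adm : Set V} {δ : ℝ} (hclose : ∀ v ∈ Adm, C.gauge (uA v) (C.transport (uB v)) ≤ δ)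
    (hCU : ∀ X : C.Dom, 0 ≤ CU gA (C.scale X)) {a b : ℝ} (ha : ∀ X : C.Dom, CU gA (C.scale X) * δ ≤ a * θ ^ C.scale X)
    (hb : ∀ X : C.Dom, (∑ i ∈ Finset.range (C.scale X), Λ (C.scale X) i * |gA i - gB i|) ≤ b * θ ^ C.scale X) :
    URate EA EB gA gB uA uB Adm (a + b + C₅) θ κ :=
  fun v hv X => u3_geometric h9 hU h5 hgA hgB (hclose v hv) X (hCU X) (ha X) (hb X)

/-- **THE INSTANCE FOR `Kind.smallFieldE`**: under `URate` the factors `f_X(v) = exp(E(X; g, U(v)) − E(X; g, U₁))`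
(vacuum-energy subtraction at the trivial background `U₁` of each run, (2.25) p. 259) satisfy the node-U5b statement on any
finite set `fac` of domains, with kind `smallFieldE`, scale `C.scale`, weight `e^{−κd(X)}`, FIELD-INDEPENDENT constants
`c_X = −(E^B(X; g^B, U₁^B) − E^A(X; g^A, U₁^A))`, kind constant `E₀′` and `δ ≡ 0` (node U2's discrepancy is already inside
`E₀′` through the coupling bracket `b`). [folklore] -/
theorem factorLogRatio_smallFieldE {EA : Functional C C.BgA} {EB : Functional C C.BgB} {gA gB : ℕ → ℝ}
    {uA : V → C.BgA} {uB : V → C.BgB} {Adm : Set V} {E₀' θ κ : ℝ} (h : URate EA EB gA gB uA uB Adm E₀' θ κ)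
    (oneA : C.BgA) (oneB : C.BgB) (fac : Finset C.Dom) (Ck : Kind → ℝ) (hCk : Ck Kind.smallFieldE = E₀') :
    FactorLogRatio Adm fac (fun _ => Kind.smallFieldE) C.scale (fun X => Real.exp (-(κ * C.d X)))
      (fun X v => Real.exp (EA gA (uA v) X - EA gA oneA X)) (fun X v => Real.exp (EB gB (uB v) X - EB gB oneB X))
      (fun X => -(EB gB oneB X - EA gA oneA X)) Ck θ (fun _ => 0) := by
  intro v hv X _
  refine ⟨Real.exp_pos _, Real.exp_pos _, ?_⟩
  rw [Real.log_exp, Real.log_exp, recentProfile, hCk, add_zero]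
  have e : EB gB (uB v) X - EB gB oneB X - (EA gA (uA v) X - EA gA oneA X) - -(EB gB oneB X - EA gA oneA X)
      = -(EA gA (uA v) X - EB gB (uB v) X) := by ring
  rw [e, abs_neg]
  exact h v hv X

/-- HYPOTHESIS SHAPE `CurrentsClose` (cell hazard H-U3-1′ of `t4/T4-XREAD-U3X2.md`, NOT PRINTED): closeness of the two
runs' data in a SECOND closeness functional `gJ` on run-A backgrounds (the 𝐉-part of the (𝐔, 𝐉) variables of (2.27)(ii)
p. 259 of [Balaban1988Convergent], after transporting run B's), along the admissible V-family. [cite: Balaban1988Convergent, (2.27) p.259] -/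
def CurrentsClose (gJ : C.BgA → C.BgA → ℝ) (uA : V → C.BgA) (uB : V → C.BgB) (Adm : Set V) (δJ : ℝ) : Prop :=
  ∀ v ∈ Adm, gJ (uA v) (C.transport (uB v)) ≤ δJ

/-- VARIANT (α) OF THE GAUGE RE-CUT (record RC1): if the carrier's gauge is dominated by a sum `gU + gJ` of a background
part and a current part, then background closeness `δU` (node U1b, NE3) AND current closeness `δJ` (`CurrentsClose`,
H-U3-1′) give the closeness `δU + δJ` consumed by `uRate_of_u3` — both inputs are explicit binders; neither is asserted.
[folklore] -/
theorem gaugeClose_of_split {gU gJ : C.BgA → C.BgA → ℝ} (hle : ∀ U U' : C.BgA, C.gauge U U' ≤ gU U U' + gJ U U')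
    {uA : V → C.BgA} {uB : V → C.BgB} {Adm : Set V} {δU δJ : ℝ}
    (hUc : ∀ v ∈ Adm, gU (uA v) (C.transport (uB v)) ≤ δU) (hJc : CurrentsClose gJ uA uB Adm δJ) :
    ∀ v ∈ Adm, C.gauge (uA v) (C.transport (uB v)) ≤ δU + δJ := fun v hv =>
  (hle _ _).trans (add_le_add (hUc v hv) (hJc v hv))

end SmallFieldE

end Literature.MathematicalPhysics.QuantumFieldTheory.Balaban1983to89.T4RecentScale
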